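import Literature.RepresentationTheory.BorelWallach2000.UpqCasimirTensor
import Literature.RepresentationTheory.BorelWallach2000.UpqComplexSpan
import HarnessLib

/-!
# Calibration of the trace-form Casimir element of `U(α, β)` on the STANDARD representation: `Σ_t y_t y'_t = n · 1`
# (`n = |α| + |β|`), with `tr(XY) ∈ ℝ` on `𝔲(α, β)` and `dim_ℝ 𝔲(α, β) = n²`

Topic `RepresentationTheory/BorelWallach2000`; namespace `Literature.RepresentationTheory.BorelWallach2000`.  THEOREMS ONLY (no
definition, no instance, no notation, no named fact, no `sorry`).  Cell `hodgecm-mathlib`, F0∕P3c line LH1 («Cal-std», LH1-p03 (g2), DEAL #5 of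
LH1-plan (g4) 2026-09-02T04:32Z; desk F0P3-plan (g14) RULING D62-pre «χ» (c4) CALIBRATION), `--supports stmt-HodgeConjecture-24833`.

THE QUESTION (desk (c4)).  The organ GLOBAL-ι^χ of the LH1 leaf ED. 2 reads the infinitesimal character of an irreducible `(𝔤, K)`-module of
`U(2,1)` through the scalar of ★ `upqCasimirOp` (the Casimir operator `C_V = Σ_t ρ𝔤(y_t) ρ𝔤(y'_t)` of the TRACE FORM `B(X, Y) = Re tr(XY)` of ★
`UpqCasimirTensor`, II §1.3 (1)) against the textbook value `χ_Λ(C) = ⟨Λ, Λ⟩ − ⟨ρ, ρ⟩`, `ρ = (1, 0, −1)` [BorelWallach2000 II Prop. 6.12 (2);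
KnappVogan1995 Prop. 4.120], i.e. `κ(a,b,c) = a² + b² + c² − 2`.  That value presumes `C = Σ_{i,j} E_{ij} E_{ji}` in `U(𝔤𝔩₃)`.  A priori the image of
the tree's `C` in `U(𝔤𝔩_n)` is an invariant quadratic `a · Σ E_{ij} E_{ji} + b · (Σ E_{ii})²` (the `𝔤`-invariant symmetric 2-tensors of `𝔤𝔩_n = 𝔷 ⊕ 𝔰𝔩_n`
form a plane), so TWO independent modules pin `(a, b)`: the determinant characters `det^m` (★ `UpqDeterminantCharacter`; for `n = 3`: `3a + 9b = 3`,
the CENTRE line — «Cχ», LH1-p01 (g3)) and the STANDARD representation `ℂⁿ` (`3a + b = 3`, this file), whence `(a, b) = (1, 0)`.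

## Contents

* §1 `upq_conjTranspose_coe` (`Xᴴ = −D X D` on `𝔲(α, β)`), **`upq_trace_mul_im_eq_zero`** (`tr(XY) ∈ ℝ` for `X, Y ∈ 𝔲(α, β)`: the real trace
  form `B = Re tr(XY)` of II §1.1 is the RESTRICTION of the complex-bilinear `tr(XY)` of `𝔤𝔩(α ⊕ β, ℂ)` to the real form `𝔲(α, β)`),
  `upq_trace_mul_eq_upqTraceForm`, `upq_trace_upqY_mul_upqY'` (`tr(y_t y'_t) = 1` for ★ `upqBasis` ∕ `upqDualBasis`).
* §2 **`upq_finrank_lie`** (`dim_ℝ 𝔲(α, β) = n²`: the real-linear isomorphism `𝔲 × 𝔲 ≅ 𝔤𝔩(α ⊕ β, ℂ)`, `(A, B) ↦ A + iB`, over ★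
  `UpqComplexSpan.upq_rePart_mem_lie` ∕ `upq_imPart_mem_lie` ∕ `upq_rePart_add_I_smul_imPart`, and `dim_ℝ 𝔤𝔩_n(ℂ) = 2n²`),
  `upq_card_basisIndex` (the index set `((α × β) × Fin 2) ⊕ Fin (upqKDim α β)` of `(y_t)` has `n²` elements).
* §3 `upq_coe_mul_sum_upqY_mul_upqY'` (the matrix `Σ_t y_t y'_t` commutes with `𝔲(α, β)` — the `𝔤`-invariance of the Casimir tensor ★
  `upq_casimirTensor_lie_invariant` pushed through `X ⊗ Y ↦ XY`), `upq_mul_sum_upqY_mul_upqY'` (hence with all of `𝔤𝔩(α ⊕ β, ℂ) = span_ℂ 𝔲(α, β)`,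
  ★ `upq_mem_span_lie`), and **`upq_sum_upqY_mul_upqY'`: `Σ_t y_t y'_t = n · 1`** — a central matrix is scalar (Mathlib
  `Matrix.mem_range_scalar_of_commute_single`) and its trace is `Σ_t tr(y_t y'_t) = dim_ℝ 𝔲(α, β) = n²`.  For `U(2,1)`: `Σ_t y_t y'_t = 3 · 1`, and
  `3 = κ(2, 0, −1)` at the Harish-Chandra parameter `(1,0,0) + ρ` of the standard representation — the SEMISIMPLE scale of the organ's formula; the
  trivial representation (`κ(1,0,−1) = 0`) tests nothing about scale, and `det^m` (`κ(m+1,m,m−1) = 3m²`) tests only the centre line.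

What is NOT here: the matrix-unit identity `Σ_t y_t ⊗ y'_t = Σ_{ij} E_{ij} ⊗ E_{ji}` in `𝔤𝔩 ⊗_ℂ 𝔤𝔩` (which would give `upqCasimirOp ρ𝔤 =
Σ_{ij} ρ_ℂ(E_{ij}) ρ_ℂ(E_{ji})` for the complexified action ★ `upqLieC` of every `(𝔤, K)`-module — the «KW» road, parked by desk (c8)); the `det^m`
half of the calibration («Cχ», `Theorems/F0P3cWignerCasimirCentral.lean`); anything about `K`.
HONEST LABEL: kernel theorems about the Lie algebra `𝔲(α, β)`; nothing printed about HC_CM is discharged here.  HC_CM is proved only modulo the 7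
printed citations (2 remaining: hLiu418 = stmt-HodgeConjecture-24832, h413 = stmt-HodgeConjecture-24833) until rung 0 closes.

## References

* A. Borel, N. Wallach, *Continuous cohomology, discrete subgroups, and representations of reductive groups*, 2nd ed., Math. Surveys Monogr. 67
  (2000), II §1.1 (3)–(5), §1.3 (1)–(2) (the Casimir element `C = Σ y_s y'_s` of `B`, independent of the basis), II Prop. 6.12 (2)
  (`π(C) = (|Λ|² − |ρ|²) · 1`). [BorelWallach2000]
* A. W. Knapp, D. A. Vogan, *Cohomological Induction and Unitary Representations* (1995), Prop. 4.120 (`χ_λ(Ω) = ⟨λ,λ⟩ − ⟨δ,δ⟩`). [KnappVogan1995]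
* A. W. Knapp, *Lie Groups Beyond an Introduction*, 2nd ed. (2002), I §1 Example (3) (`𝔲(p,q)` is a real form of `𝔤𝔩(p+q, ℂ)`), V §4
  (5.24)–(5.25) (basis independence of the Casimir element). [Knapp2002]
* N. Bourbaki, *Lie Groups and Lie Algebras*, Ch. I §3.7 Prop. 11 (invariance of the Casimir tensor).
-/

noncomputable section

open scoped TensorProduct Matrix

namespace Literature.RepresentationTheory.BorelWallach2000

open Literature.Algebra.Lie
open Literature.NumberTheory.Automorphic
open Literature.RepresentationTheory.KonnoKonno2007
open Literature.RepresentationTheory.KonnoKonno2007.RealDualPair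
open Literature.RepresentationTheory.KonnoKonno2007.RealDualPair.UForm

-- Mathlib idiom (as in `GKModules`, `UpqCasimirTensor`): commutator bracket on `Module.End` / matrices

variable {α β : Type*} [Fintype α] [DecidableEq α] [Fintype β] [DecidableEq β]

/-! ## §1 The trace form is the restriction of the complex-bilinear `tr(XY)` to the real form `𝔲(α, β)` -/

section Reality

/-- `Xᴴ = −D X D` for `X ∈ 𝔲(α, β)` (`D = diag(1_α, −1_β)`, `D² = 1`). [cite: Knapp2002, I §1 Example (3)] -/
theorem upq_conjTranspose_coe (X : (uFormGroup α β).lie) :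
    (X : Matrix (α ⊕ β) (α ⊕ β) ℂ)ᴴ = -(signForm α β * (X : Matrix (α ⊕ β) (α ⊕ β) ℂ) * signForm α β) := by
  have h := (upq_mem_lie_iff_signForm_conjTranspose_signForm (X : Matrix (α ⊕ β) (α ⊕ β) ℂ)).1 X.2
  -- conjugate `D Xᴴ D = −X` by `D`
  have h' : signForm α β * (signForm α β * (X : Matrix (α ⊕ β) (α ⊕ β) ℂ)ᴴ * signForm α β) * signForm α β =
      signForm α β * (-(X : Matrix (α ⊕ β) (α ⊕ β) ℂ)) * signForm α β := by rw [h]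
  rw [← Matrix.mul_assoc, ← Matrix.mul_assoc, signForm_mul_signForm, Matrix.one_mul, Matrix.mul_assoc,
    signForm_mul_signForm, Matrix.mul_one] at h'
  rw [h', Matrix.mul_neg, Matrix.neg_mul]

/-- **`tr(XY)` is REAL for `X, Y ∈ 𝔲(α, β)`**: `(XY)ᴴ = Yᴴ Xᴴ = D (YX) D`, so `conj tr(XY) = tr(YX) = tr(XY)` — the real
trace form `B(X, Y) = Re tr(XY)` of ★ `upqTraceForm` is the restriction to the real form `𝔲(α, β)` of the complex-bilinear
form `tr(XY)` of `𝔤𝔩(α ⊕ β, ℂ)`. [cite: BorelWallach2000, II §1.1 (3)] [cite: Knapp2002, I §1 Example (3)] -/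
theorem upq_trace_mul_im_eq_zero (X Y : (uFormGroup α β).lie) :
    (((X : Matrix (α ⊕ β) (α ⊕ β) ℂ) * (Y : Matrix (α ⊕ β) (α ⊕ β) ℂ)).trace).im = 0 := by
  have hconj : (((X : Matrix (α ⊕ β) (α ⊕ β) ℂ) * (Y : Matrix (α ⊕ β) (α ⊕ β) ℂ))ᴴ).trace =
      ((X : Matrix (α ⊕ β) (α ⊕ β) ℂ) * (Y : Matrix (α ⊕ β) (α ⊕ β) ℂ)).trace := by
    rw [Matrix.conjTranspose_mul, upq_conjTranspose_coe, upq_conjTranspose_coe, neg_mul_neg,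
      Matrix.mul_assoc (signForm α β * (Y : Matrix (α ⊕ β) (α ⊕ β) ℂ)) (signForm α β) _,
      ← Matrix.mul_assoc (signForm α β) (signForm α β * (X : Matrix (α ⊕ β) (α ⊕ β) ℂ)) (signForm α β),
      ← Matrix.mul_assoc (signForm α β) (signForm α β) (X : Matrix (α ⊕ β) (α ⊕ β) ℂ), signForm_mul_signForm,
      Matrix.one_mul, Matrix.trace_mul_comm, Matrix.mul_assoc, ← Matrix.mul_assoc (signForm α β) (signForm α β),
      signForm_mul_signForm, Matrix.one_mul]
  rw [Matrix.trace_conjTranspose, Complex.star_def] at hconj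
  exact Complex.conj_eq_iff_im.1 hconj

/-- `tr(XY) = B(X, Y)` as a complex number, for `X, Y ∈ 𝔲(α, β)`. [cite: BorelWallach2000, II §1.1 (3)] -/
theorem upq_trace_mul_eq_upqTraceForm (X Y : (uFormGroup α β).lie) :
    ((X : Matrix (α ⊕ β) (α ⊕ β) ℂ) * (Y : Matrix (α ⊕ β) (α ⊕ β) ℂ)).trace = ((upqTraceForm α β X Y : ℝ) : ℂ) := by
  rw [upqTraceForm_apply]
  exact Complex.ext (by rw [Complex.ofReal_re]) (by rw [Complex.ofReal_im, upq_trace_mul_im_eq_zero])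

/-- `tr(y_t y'_t) = 1` for the basis `(y_t)` of ★ `upqBasis` and its `B`-dual `(y'_t)` (★ `upqDualBasis`).
[cite: BorelWallach2000, II §1.3 (1)] -/
theorem upq_trace_upqY_mul_upqY' (t : ((α × β) × Fin 2) ⊕ Fin (upqKDim α β)) :
    (((upqY α β t : (uFormGroup α β).lie) : Matrix (α ⊕ β) (α ⊕ β) ℂ) *
        ((upqY' α β t : (uFormGroup α β).lie) : Matrix (α ⊕ β) (α ⊕ β) ℂ)).trace = 1 := by
  rw [upq_trace_mul_eq_upqTraceForm]
  rcases t with s | a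
  · change ((upqTraceForm α β (upqPBasis s) (upqPBasis s) : ℝ) : ℂ) = 1
    rw [upqTraceForm_upqPBasis, if_pos rfl, Complex.ofReal_one]
  · change ((upqTraceForm α β (upqKVec α β a) (upqKDual α β a) : ℝ) : ℂ) = 1
    rw [upqKDual_eq_neg, map_neg, upqTraceForm_upqKVec, if_pos rfl, neg_neg, Complex.ofReal_one]

end Reality

/-! ## §2 `dim_ℝ 𝔲(α, β) = n²` (`𝔲(α, β)` is a real form of `𝔤𝔩_n(ℂ)`, `n = |α| + |β|`) -/

section Dimension

/-- Real scalars on `𝔲(α, β) ≤ 𝔤𝔩(α ⊕ β, ℂ)` act through `ℝ → ℂ` on the matrix. [folklore] -/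
private theorem upq_coe_real_smul (r : ℝ) (X : (uFormGroup α β).lie) :
    ((r • X : (uFormGroup α β).lie) : Matrix (α ⊕ β) (α ⊕ β) ℂ) = (r : ℂ) • (X : Matrix (α ⊕ β) (α ⊕ β) ℂ) := by
  change r • (X : Matrix (α ⊕ β) (α ⊕ β) ℂ) = _
  rw [Complex.coe_smul]

/-- **`dim_ℝ 𝔲(α, β) = (|α| + |β|)²`**: `(A, B) ↦ A + iB` is a real-linear isomorphism `𝔲(α, β) × 𝔲(α, β) ≅ 𝔤𝔩(α ⊕ β, ℂ)`
(★ `upq_rePart_mem_lie`, `upq_imPart_mem_lie`, `upq_rePart_add_I_smul_imPart`), and `dim_ℝ 𝔤𝔩_n(ℂ) = 2n²`.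
[cite: Knapp2002, I §1 Example (3)] -/
theorem upq_finrank_lie :
    Module.finrank ℝ (uFormGroup α β).lie = Fintype.card (α ⊕ β) * Fintype.card (α ⊕ β) := by
  have hD : ∀ X : (uFormGroup α β).lie,
      signForm α β * (X : Matrix (α ⊕ β) (α ⊕ β) ℂ)ᴴ * signForm α β = -(X : Matrix (α ⊕ β) (α ⊕ β) ℂ) :=
    fun X => (upq_mem_lie_iff_signForm_conjTranspose_signForm _).1 X.2
  -- `D (A + iB)ᴴ D = −A + iB` for `A, B ∈ 𝔲(α, β)`
  have hAB : ∀ A B : (uFormGroup α β).lie,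
      signForm α β * ((A : Matrix (α ⊕ β) (α ⊕ β) ℂ) + Complex.I • (B : Matrix (α ⊕ β) (α ⊕ β) ℂ))ᴴ * signForm α β =
        -(A : Matrix (α ⊕ β) (α ⊕ β) ℂ) + Complex.I • (B : Matrix (α ⊕ β) (α ⊕ β) ℂ) := by
    intro A B
    rw [Matrix.conjTranspose_add, Matrix.conjTranspose_smul, Matrix.mul_add, Matrix.add_mul, Matrix.mul_smul,
      Matrix.smul_mul, hD A, hD B, Complex.star_def, Complex.conj_I, neg_smul, smul_neg, neg_neg]
  let e : ((uFormGroup α β).lie × (uFormGroup α β).lie) ≃ₗ[ℝ] Matrix (α ⊕ β) (α ⊕ β) ℂ :=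
    { toFun := fun p => (p.1 : Matrix (α ⊕ β) (α ⊕ β) ℂ) + Complex.I • (p.2 : Matrix (α ⊕ β) (α ⊕ β) ℂ)
      map_add' := fun p q => by
        simp only [Prod.fst_add, Prod.snd_add, AddMemClass.coe_add, smul_add]
        abel
      map_smul' := fun r p => by
        change r • (p.1 : Matrix (α ⊕ β) (α ⊕ β) ℂ) + Complex.I • (r • (p.2 : Matrix (α ⊕ β) (α ⊕ β) ℂ)) =
          r • ((p.1 : Matrix (α ⊕ β) (α ⊕ β) ℂ) + Complex.I • (p.2 : Matrix (α ⊕ β) (α ⊕ β) ℂ))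
        rw [smul_add, smul_comm r Complex.I]
      invFun := fun M => (⟨_, upq_rePart_mem_lie M⟩, ⟨_, upq_imPart_mem_lie M⟩)
      left_inv := fun p => by
        obtain ⟨A, B⟩ := p
        simp only [Prod.mk.injEq]
        refine ⟨Subtype.ext ?_, Subtype.ext ?_⟩
        · change (2⁻¹ : ℂ) • (((A : Matrix (α ⊕ β) (α ⊕ β) ℂ) + Complex.I • (B : Matrix (α ⊕ β) (α ⊕ β) ℂ)) -
              signForm α β * ((A : Matrix (α ⊕ β) (α ⊕ β) ℂ) + Complex.I • (B : Matrix (α ⊕ β) (α ⊕ β) ℂ))ᴴ *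
                signForm α β) = (A : Matrix (α ⊕ β) (α ⊕ β) ℂ)
          rw [hAB, add_sub_add_right_eq_sub, sub_neg_eq_add, ← two_smul ℂ (A : Matrix (α ⊕ β) (α ⊕ β) ℂ), smul_smul]
          norm_num
        · change (-(Complex.I / 2)) • (((A : Matrix (α ⊕ β) (α ⊕ β) ℂ) + Complex.I • (B : Matrix (α ⊕ β) (α ⊕ β) ℂ)) +
              signForm α β * ((A : Matrix (α ⊕ β) (α ⊕ β) ℂ) + Complex.I • (B : Matrix (α ⊕ β) (α ⊕ β) ℂ))ᴴ *
                signForm α β) = (B : Matrix (α ⊕ β) (α ⊕ β) ℂ)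
          rw [hAB, add_add_add_comm, add_neg_cancel, zero_add, ← two_smul ℂ, smul_smul, smul_smul,
            show -(Complex.I / 2) * 2 * Complex.I = 1 by
              rw [neg_mul, div_mul_cancel₀ _ (two_ne_zero' ℂ), neg_mul, Complex.I_mul_I, neg_neg], one_smul]
      right_inv := fun M => upq_rePart_add_I_smul_imPart M }
  haveI : Module.Finite ℝ (uFormGroup α β).lie := Module.Finite.of_basis (upqBasis α β)
  have h := e.finrank_eq
  rw [Module.finrank_prod, Module.finrank_matrix, Complex.finrank_real_complex] at h
  omega

/-- The index set of the basis `(y_t) = (x_s) ∪ (w_a)` of ★ `upqBasis` has `n²` elements. [cite: BorelWallach2000, II §1.3 (1)] -/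
theorem upq_card_basisIndex :
    Fintype.card (((α × β) × Fin 2) ⊕ Fin (upqKDim α β)) = Fintype.card (α ⊕ β) * Fintype.card (α ⊕ β) := by
  rw [← Module.finrank_eq_card_basis (upqBasis α β), upq_finrank_lie]

end Dimension

/-! ## §3 The Casimir ELEMENT `Σ_t y_t y'_t` in the standard representation is `n · 1` -/

section Standard

/-- **`Σ_t y_t y'_t` commutes with `𝔲(α, β)`** (as a product of matrices): apply `X ⊗ Y ↦ XY` to the `𝔤`-invariance of the
Casimir tensor (★ `upq_casimirTensor_lie_invariant`) — `[z, y] y' + y [z, y'] = z (y y') − (y y') z`.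
[cite: BorelWallach2000, II §1.3 (1)] -/
theorem upq_coe_mul_sum_upqY_mul_upqY' (z : (uFormGroup α β).lie) :
    (z : Matrix (α ⊕ β) (α ⊕ β) ℂ) *
        ∑ t, ((upqY α β t : (uFormGroup α β).lie) : Matrix (α ⊕ β) (α ⊕ β) ℂ) *
          ((upqY' α β t : (uFormGroup α β).lie) : Matrix (α ⊕ β) (α ⊕ β) ℂ) =
      (∑ t, ((upqY α β t : (uFormGroup α β).lie) : Matrix (α ⊕ β) (α ⊕ β) ℂ) *
          ((upqY' α β t : (uFormGroup α β).lie) : Matrix (α ⊕ β) (α ⊕ β) ℂ)) * (z : Matrix (α ⊕ β) (α ⊕ β) ℂ) := by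
  -- the real-bilinear multiplication map `𝔲 × 𝔲 → 𝔤𝔩`
  let Φ : (uFormGroup α β).lie →ₗ[ℝ] (uFormGroup α β).lie →ₗ[ℝ] Matrix (α ⊕ β) (α ⊕ β) ℂ :=
    LinearMap.mk₂ ℝ (fun X Y => (X : Matrix (α ⊕ β) (α ⊕ β) ℂ) * (Y : Matrix (α ⊕ β) (α ⊕ β) ℂ))
      (fun X X' Y => by rw [AddMemClass.coe_add, Matrix.add_mul])
      (fun c X Y => by
        change (c • (X : Matrix (α ⊕ β) (α ⊕ β) ℂ)) * (Y : Matrix (α ⊕ β) (α ⊕ β) ℂ) =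
          c • ((X : Matrix (α ⊕ β) (α ⊕ β) ℂ) * (Y : Matrix (α ⊕ β) (α ⊕ β) ℂ))
        exact smul_mul_assoc c _ _)
      (fun X Y Y' => by rw [AddMemClass.coe_add, Matrix.mul_add])
      (fun c X Y => by
        change (X : Matrix (α ⊕ β) (α ⊕ β) ℂ) * (c • (Y : Matrix (α ⊕ β) (α ⊕ β) ℂ)) =
          c • ((X : Matrix (α ⊕ β) (α ⊕ β) ℂ) * (Y : Matrix (α ⊕ β) (α ⊕ β) ℂ))
        exact mul_smul_comm c _ _)
  have h := congrArg (TensorProduct.lift Φ) (upq_casimirTensor_lie_invariant z)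
  rw [map_sum, map_zero] at h
  simp only [map_add, TensorProduct.lift.tmul] at h
  have hΦ : ∀ X Y : (uFormGroup α β).lie, Φ X Y = (X : Matrix (α ⊕ β) (α ⊕ β) ℂ) * (Y : Matrix (α ⊕ β) (α ⊕ β) ℂ) :=
    fun X Y => rfl
  simp only [hΦ, LieSubalgebra.coe_bracket, Ring.lie_def, Matrix.sub_mul, Matrix.mul_sub] at h
  -- `h : Σ_t ((z y − y z) y' + (y (z y') − y (y' z))) = 0`
  rw [Finset.mul_sum, Finset.sum_mul, ← sub_eq_zero, ← Finset.sum_sub_distrib, ← h]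
  refine Finset.sum_congr rfl fun t _ => ?_
  simp only [upqY, upqY', Matrix.mul_assoc]
  abel

/-- **`Σ_t y_t y'_t` commutes with every complex matrix** (`𝔲(α, β)` spans `𝔤𝔩(α ⊕ β, ℂ)` over `ℂ`, ★ `upq_mem_span_lie`).
[cite: BorelWallach2000, II §1.3 (1)] [cite: Knapp2002, I §1 Example (3)] -/
theorem upq_mul_sum_upqY_mul_upqY' (N : Matrix (α ⊕ β) (α ⊕ β) ℂ) :
    N * ∑ t, ((upqY α β t : (uFormGroup α β).lie) : Matrix (α ⊕ β) (α ⊕ β) ℂ) *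
          ((upqY' α β t : (uFormGroup α β).lie) : Matrix (α ⊕ β) (α ⊕ β) ℂ) =
      (∑ t, ((upqY α β t : (uFormGroup α β).lie) : Matrix (α ⊕ β) (α ⊕ β) ℂ) *
          ((upqY' α β t : (uFormGroup α β).lie) : Matrix (α ⊕ β) (α ⊕ β) ℂ)) * N := by
  refine Submodule.span_induction (p := fun N _ => N * _ = _ * N) ?_ ?_ ?_ ?_ (upq_mem_span_lie N)
  · intro z hz
    exact upq_coe_mul_sum_upqY_mul_upqY' ⟨z, hz⟩
  · rw [Matrix.zero_mul, Matrix.mul_zero]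
  · intro M M' _ _ hM hM'
    rw [Matrix.add_mul, Matrix.mul_add, hM, hM']
  · intro c M _ hM
    rw [Matrix.smul_mul, Matrix.mul_smul, hM]

/-- **CALIBRATION 1 — THE STANDARD REPRESENTATION: the Casimir element `Σ_t y_t y'_t` of the trace form of `𝔲(α, β)` is the
matrix `n · 1`, `n = |α| + |β|`** (it is central in `𝔤𝔩_n(ℂ)`, hence scalar, of trace `Σ_t tr(y_t y'_t) = Σ_t B(y_t, y'_t) = dim 𝔲(α,β) = n²`).
For `U(2,1)`: `3` = `κ(2, 0, −1)` with `κ(a,b,c) = a² + b² + c² − 2` at the infinitesimal character `(1,0,0) + ρ`, `ρ = (1,0,−1)`, of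
the standard representation — the normalisation `C ↦ ⟨λ+ρ, λ+ρ⟩ − ⟨ρ, ρ⟩` of the SEMISIMPLE part. [cite: BorelWallach2000, II §1.3 (1)–(2); II Prop. 6.12 (2)] [cite: KnappVogan1995, Prop. 4.120 (p. 280)] -/
theorem upq_sum_upqY_mul_upqY' :
    ∑ t, ((upqY α β t : (uFormGroup α β).lie) : Matrix (α ⊕ β) (α ⊕ β) ℂ) *
        ((upqY' α β t : (uFormGroup α β).lie) : Matrix (α ⊕ β) (α ⊕ β) ℂ) =
      (Fintype.card (α ⊕ β) : ℂ) • (1 : Matrix (α ⊕ β) (α ⊕ β) ℂ) := by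
  set C := ∑ t, ((upqY α β t : (uFormGroup α β).lie) : Matrix (α ⊕ β) (α ⊕ β) ℂ) *
    ((upqY' α β t : (uFormGroup α β).lie) : Matrix (α ⊕ β) (α ⊕ β) ℂ) with hC
  -- `C` is scalar
  obtain ⟨c, hc⟩ : C ∈ Set.range (Matrix.scalar (α ⊕ β)) :=
    Matrix.mem_range_scalar_of_commute_single fun i j _ => upq_mul_sum_upqY_mul_upqY' _
  -- its trace is `n²`
  have htr : C.trace = (Fintype.card (α ⊕ β) : ℂ) * Fintype.card (α ⊕ β) := by
    rw [hC, Matrix.trace_sum]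
    simp only [upq_trace_upqY_mul_upqY', Finset.sum_const, Finset.card_univ, nsmul_eq_mul, mul_one, upq_card_basisIndex,
      Nat.cast_mul]
  rcases isEmpty_or_nonempty (α ⊕ β) with hε | hne
  · haveI := hε
    exact Subsingleton.elim _ _
  · have hn : (Fintype.card (α ⊕ β) : ℂ) ≠ 0 := Nat.cast_ne_zero.2 Fintype.card_ne_zero
    rw [← hc, Matrix.scalar_apply, Matrix.trace_diagonal, Finset.sum_const, Finset.card_univ, nsmul_eq_mul] at htr
    have hcn : c = Fintype.card (α ⊕ β) := mul_left_cancel₀ hn htr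
    rw [← hc, hcn, Matrix.scalar_apply, ← Matrix.diagonal_one, ← Matrix.diagonal_smul]
    congr 1
    funext i
    rw [Pi.smul_apply, smul_eq_mul, mul_one]

end Standard

end Literature.RepresentationTheory.BorelWallach2000

end
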